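import Literature.AnabelianGeometry.SemiGraphs.PSCEdgeLikeCharacterizationReduction
import Literature.AnabelianGeometry.SemiGraphs.PSCThm16CapstoneProofs
import HarnessLib

/-!
# [CombGC] Theorem 1.6 AS TYPED from ELEVEN origin statements: the two [IUTchI] Rmk. 1.2.3 (iv)/(v) inputs are redundant

Mochizuki, *A combinatorial version of the Grothendieck conjecture*, Tohoku Math. J. **59** (2007)
[CombGC], Theorem 1.6 (i)(ii)(iii) p. 13 [cite: MochizukiCombGC2007, Thm 1.6 p.13].  The tree's CAPSTONE
`thm16_holds_of_inputs` (abc-iut-w5-d183, `PSCThm16CapstoneProofs.lean`; sub-DAG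
`plan/L3/SUBDAG-CombGC-Thm16.md` row T16-CAPSTONE) derives the three typed statements
`NumericallyCuspidalIffHolds Ω ∧ GraphicIffFiltrationPreservingHolds Ω ∧ UnrVerticialIffHolds Ω`
(FACT-LIST rows F-0458, F-0444, F-0461) at every origin `Ω` of profinite data from THIRTEEN origin
statements consumed by name, among them the cuspidal and nodal edge-like characterizations of [IUTchI]
Rmk. 1.2.3 (iv)/(v), `CuspidalEdgeLikeCharacterizationHolds` (F-1931) and
`NodalEdgeLikeCharacterizationHolds` (F-1937), and [CombGC] Prop. 1.2 (i)
`OpenInterDeterminesComponentHolds` (F-0459).  PROOF-ONLY file (abc-iut-w5-d160, D-0079 L-F row F-1937;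
no definitions).

By `cuspidalEdgeLikeCharacterizationHolds_of_openInter` / `nodalEdgeLikeCharacterizationHolds_of_openInter`
(`PSCEdgeLikeCharacterizationReduction.lean`: Rmk. 1.2.3 (iv)/(v) ⇐ Prop. 1.2 (i) edge clause, for
profinite topologically finitely generated `Π` with topologically procyclic, infinite edge groups — the
printed "one verifies immediately"), the two Rmk. 1.2.3 inputs FOLLOW from the Prop. 1.2 (i) input.  Hence:

* `thm16_holds_of_eleven_inputs` — Theorem 1.6 (i) ∧ (ii) ∧ (iii) as typed from the ELEVEN remaining
  origin statements, at every origin whose data live on profinite, topologically finitely generated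
  groups with procyclic infinite node and cusp groups (displayed `hprof`; [CombGC] Rmk. 1.1.3 "`Π_e ≅ Ẑ^Σ`"
  and Def. 1.1 (ii) "`Π_G` … topologically finitely generated" for the intended data);
* `thm16_holds_of_separating_ten_inputs` — the same from TEN statements when Prop. 1.2 (i)(ii) are
  replaced by their common source `SeparatingCoveringsHolds` (abc-iut-w5-d183's
  `thm16_holds_of_separating`).

Every remaining input is an origin statement consumed BY NAME (assumption labels, not assertions about
curves); typed ≠ proved for those statements; nothing here takes a side on [IUTchIII] Cor. 3.12.
[cite: Mochizuki2012, IUTchI Rmk 1.2.3(iv)-(v) pp.41-43] [cite: MochizukiCombGC2007, Prop 1.2(i) p.8]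
-/

noncomputable section

namespace Literature.AnabelianGeometry.SemiGraphs

namespace PSCDatum

open Literature.AnabelianGeometry.AbsoluteAnabelian (IsTopologicallyFinitelyGenerated)

universe u

section Capstone

variable (Ω : PSCOrigin.{u})

/-- **[CombGC] Theorem 1.6 AS TYPED, (i) ∧ (ii) ∧ (iii), from ELEVEN origin statements** — the capstone
`thm16_holds_of_inputs` with its inputs `CuspidalEdgeLikeCharacterizationHolds` (F-1931) and
`NodalEdgeLikeCharacterizationHolds` (F-1937) DISCHARGED from `OpenInterDeterminesComponentHolds` (F-0459)
by [IUTchI] Rmk. 1.2.3 (iv)/(v) ⇐ [CombGC] Prop. 1.2 (i), at every origin of profinite, topologically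
finitely generated data whose node and cusp groups are topologically procyclic and infinite.
[cite: MochizukiCombGC2007, Thm 1.6 p.13] -/
theorem thm16_holds_of_eleven_inputs
    (hprof : ∀ ⦃Q : Type u⦄ [Group Q] [TopologicalSpace Q] [IsTopologicalGroup Q] (K : PSCDatum Q),
      Ω.IsOfPSCType K → CompactSpace Q ∧ TotallyDisconnectedSpace Q ∧ IsTopologicallyFinitelyGenerated Q ∧
        (∀ e : K.graph.N, ∃ a : Q, (Subgroup.zpowers a).topologicalClosure = K.nodeGp e) ∧
        (∀ e : K.graph.N, (K.nodeGp e : Set Q).Infinite) ∧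
        (∀ c : K.graph.C, ∃ a : Q, (Subgroup.zpowers a).topologicalClosure = K.cuspGp c) ∧
        ∀ c : K.graph.C, (K.cuspGp c : Set Q).Infinite)
    (hrank : RankStatementsHold Ω) (hcpt : CompactifyOfPSCTypeHolds Ω)
    (hres : RestrictBDOfPSCTypeHolds Ω) (hcover : SturdyCoverHolds Ω)
    (hopen : OpenInterDeterminesComponentHolds Ω) (hCT : CommensurableTerminalityHolds Ω)
    (hP15 : GraphicIffEdgeLikeVerticialHolds Ω) (hunr : UnrVerticialCharacterizationHolds' Ω)
    (hrankv : UnrVertAbOfRankHolds Ω) (hconn : VertCountLeNodeCountSuccHolds Ω)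
    (hmap : MapAlongProLOfPSCTypeHolds Ω) :
    Literature.AnabelianGeometry.SemiGraphs.PSCDatum.NumericallyCuspidalIffHolds Ω ∧
      Literature.AnabelianGeometry.SemiGraphs.PSCDatum.GraphicIffFiltrationPreservingHolds Ω ∧
        Literature.AnabelianGeometry.SemiGraphs.PSCDatum.UnrVerticialIffHolds Ω :=
  thm16_holds_of_inputs Ω (fun _ _ _ _ K hK => ⟨(hprof K hK).1, (hprof K hK).2.1⟩) hrank
    (cuspidalEdgeLikeCharacterizationHolds_of_openInter Ω
      (fun _ _ _ _ K hK => ⟨(hprof K hK).1, (hprof K hK).2.1, (hprof K hK).2.2.1,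
        (hprof K hK).2.2.2.2.2.1, (hprof K hK).2.2.2.2.2.2⟩) hopen)
    (nodalEdgeLikeCharacterizationHolds_of_openInter Ω
      (fun _ _ _ _ K hK => ⟨(hprof K hK).1, (hprof K hK).2.1, (hprof K hK).2.2.1,
        (hprof K hK).2.2.2.1, (hprof K hK).2.2.2.2.1⟩) hopen)
    hcpt hres hcover hopen hCT hP15 hunr hrankv hconn hmap

/-- **[CombGC] Theorem 1.6 AS TYPED, (i) ∧ (ii) ∧ (iii), from TEN origin statements** — as
`thm16_holds_of_eleven_inputs`, with Prop. 1.2 (i)(ii) replaced by their common source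
`SeparatingCoveringsHolds` (abc-iut-w5-d183's `openInterDeterminesComponentHolds_of_separating`,
`commensurableTerminalityHolds_of_separating`). [cite: MochizukiCombGC2007, Thm 1.6 p.13]
[cite: MochizukiCombGC2007, Prop 1.2 p.8] -/
theorem thm16_holds_of_separating_ten_inputs
    (hprof : ∀ ⦃Q : Type u⦄ [Group Q] [TopologicalSpace Q] [IsTopologicalGroup Q] (K : PSCDatum Q),
      Ω.IsOfPSCType K → CompactSpace Q ∧ TotallyDisconnectedSpace Q ∧ IsTopologicallyFinitelyGenerated Q ∧
        (∀ e : K.graph.N, ∃ a : Q, (Subgroup.zpowers a).topologicalClosure = K.nodeGp e) ∧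
        (∀ e : K.graph.N, (K.nodeGp e : Set Q).Infinite) ∧
        (∀ c : K.graph.C, ∃ a : Q, (Subgroup.zpowers a).topologicalClosure = K.cuspGp c) ∧
        ∀ c : K.graph.C, (K.cuspGp c : Set Q).Infinite)
    (hsep : SeparatingCoveringsHolds Ω)
    (hrank : RankStatementsHold Ω) (hcpt : CompactifyOfPSCTypeHolds Ω)
    (hres : RestrictBDOfPSCTypeHolds Ω) (hcover : SturdyCoverHolds Ω)
    (hP15 : GraphicIffEdgeLikeVerticialHolds Ω) (hunr : UnrVerticialCharacterizationHolds' Ω)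
    (hrankv : UnrVertAbOfRankHolds Ω) (hconn : VertCountLeNodeCountSuccHolds Ω)
    (hmap : MapAlongProLOfPSCTypeHolds Ω) :
    Literature.AnabelianGeometry.SemiGraphs.PSCDatum.NumericallyCuspidalIffHolds Ω ∧
      Literature.AnabelianGeometry.SemiGraphs.PSCDatum.GraphicIffFiltrationPreservingHolds Ω ∧
        Literature.AnabelianGeometry.SemiGraphs.PSCDatum.UnrVerticialIffHolds Ω :=
  have hprof' : ∀ ⦃Q : Type u⦄ [Group Q] [TopologicalSpace Q] [IsTopologicalGroup Q] (K : PSCDatum Q),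
      Ω.IsOfPSCType K → CompactSpace Q ∧ TotallyDisconnectedSpace Q :=
    fun _ _ _ _ K hK => ⟨(hprof K hK).1, (hprof K hK).2.1⟩
  thm16_holds_of_eleven_inputs Ω hprof hrank hcpt hres hcover
    (openInterDeterminesComponentHolds_of_separating Ω hsep hprof')
    (commensurableTerminalityHolds_of_separating Ω hsep hprof') hP15 hunr hrankv hconn hmap

end Capstone

end PSCDatum

end Literature.AnabelianGeometry.SemiGraphs

end
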